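import Literature.AlgebraicGeometry.Frobenioids.PadicKummerThm24iFrobenioidRelOfEquivalence
import Literature.AlgebraicGeometry.Frobenioids.PadicFrobenioidGoodLocalKit
import HarnessLib

/-!
# Frobenioids II, §2 with `Π° = Π`: `𝓑^temp(Π)⁰ = 𝓑^temp(Π, Π)⁰` at the level of `p`-adic Frobenioid data, and
# Theorem 2.4 (i) for the `p`-adic Frobenioids over the ABSOLUTE small bases `CosetCat Π`

Mochizuki, *The geometry of Frobenioids II*, Kyushu J. Math. **62** (2008) 401–460, §1 Example 1.3 (i) p. 11
[cite: MochizukiFrdII2008, Ex 1.3 (i) p.11] ("`𝓑^temp(Π, Π°) ⊆ 𝓑^temp(Π)` [is] the full subcategory determined by the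
objects that admit a morphism to the object `Π/Π°`" — for `Π° = Π` every object does); §2 Theorem 2.4 (i) p. 19
[cite: MochizukiFrdII2008, Thm 2.4 (i) p.19] ("`Cᵢ` a `pᵢ`-adic Frobenioid whose base category `Dᵢ` is of the form
`Dᵢ = 𝓑^temp(Πᵢ, Πᵢ°)⁰` … where `Πᵢ → G_{ℚ_{pᵢ}}` is an open homomorphism").

WHY THIS FILE (seat abc-iut-L1-t7 gen 7, cell row «T24ii-JUNCTION», `plan/L1/SUBDAG-FrdII-Thm24.md`). The cell types the
genuine bases of §2 in TWO small models: abc-iut-w5-d229's Theorem 2.4 (ii) chain (`PadicFrobenioidPairIso*`,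
`BaseGaloisSystem.exists_pairIso_unitsTransport_padic`) lives over the ABSOLUTE coset category, `d : PadicFrd.Datum (CosetCat Π) p`
with `d.base = CosetCat.push φ _ ⋙ CosetCat.toConnected _ ⋙ galoisPadicFields p`, whereas abc-iut-L1-t7's Theorem 2.4 (i) chain
(`PadicKummer.Def22Context.thm24i_ofEquivalenceRel`, the context isomorphism `isoOfEquivalenceRel` = residual (R1) of the
Theorem 2.4 (ii) closer) lives over the RELATIVE model `Datum (RelCosetCat Π°) p`, `d.base = PadicFrd.relBaseGal p Π° φ hφ =
RelCosetCat.incl Π° ⋙ (the absolute base)`. This file identifies the two for `Π° = Π`, ON THE NOSE: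

* `CosetCat.toRelTop : CosetCat Π ⥤ RelCosetCat ⊤` — inverse to `RelCosetCat.incl ⊤` with both composites EQUAL to the
  identity (`toRelTop_comp_incl`, `incl_comp_toRelTop`, `rfl`), packaged as `CosetCat.relTopEquiv`;
* `PadicFrd.Datum.relTop d : Datum (RelCosetCat ⊤) p` — the datum restricted along `incl ⊤` (same `Φ`, `B`, `Div_B`; its base
  is `relBaseGal p ⊤ φ hφ` as soon as `d.base` is the absolute genuine base, `relTop_base_eq`);
* `Datum.toRelTopFrob : C ⥤ C♭` — inverse ON THE NOSE to abc-iut-w4's `ModelFrobenioid.baseChange (incl ⊤)` ([FrdI] Thm. 5.2 (i)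
  functoriality, `PadicFrobenioidGoodLocalKit`), `Datum.frobRelTopEquiv : C ≌ C♭`, and the transport `relTopEquivalence Ψ :
  C₁♭ ≌ C₂♭` of an equivalence `Ψ : C₁ ⥲ C₂` with `(relTopEquivalence Ψ).functor.obj A♭ = (Ψ A)♭` definitionally;
* hence **`PadicKummer.Def22Context.thm24i_ofEquivalenceAbs`**: abc-iut-L1-t7 gen 6's Theorem 2.4 (i) from an equivalence
  `Ψ` alone, now for `pᵢ`-adic Frobenioids over the absolute bases `CosetCat Πᵢ` of abc-iut-w5-d229's chain — so that the
  context isomorphism (R1) and the pair `(α, ψ̄)` (R2) of Theorem 2.4 (ii) are available on the SAME data; with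
  `isoGOfEquivalenceRel` naming the representative `G₁ ⥲ G₂` that the printed assumption `map_H` and the (ii)-junction
  "`α ↔ isoG`" refer to (`isoOfEquivalenceRel_isoG`).
Category-theoretic bookkeeping over landed files; nothing of [FrdI]/[FrdII] is re-typed; nothing here concerns [IUTchIII].
-/

noncomputable section

/-! ### §1 `𝓑^temp(Π)⁰ = 𝓑^temp(Π, Π)⁰` on the small models -/

namespace Literature.AnabelianGeometry.SemiGraphs

open CategoryTheory

universe u

namespace CosetCat

variable {G : Type u} [Group G] [TopologicalSpace G]

/-- For `Π° = Π` every `Π/U` "admits a morphism to the object `Π/Π°`". [cite: MochizukiFrdII2008, Ex 1.3 (i) p.11] -/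
theorem admitsHomTo_top (X : CosetCat G) : admitsHomTo ⊤ X := admitsHomTo_of_le ⊤ le_top

/-- `𝓑^temp(Π)⁰ ⥤ 𝓑^temp(Π, Π)⁰` (the identity on objects and morphisms). [cite: MochizukiFrdII2008, Ex 1.3 (i) p.11] -/
def toRelTop : CosetCat G ⥤ RelCosetCat (⊤ : OpenSubgroup G) :=
  (admitsHomTo ⊤).lift (𝟭 (CosetCat G)) admitsHomTo_top

/-- `toRelTop` followed by the inclusion is the identity, on the nose. [cite: MochizukiFrdII2008, Ex 1.3 (i) p.11] -/
theorem toRelTop_comp_incl : toRelTop ⋙ RelCosetCat.incl ⊤ = 𝟭 (CosetCat G) := rfl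

/-- The inclusion followed by `toRelTop` is the identity, on the nose. [cite: MochizukiFrdII2008, Ex 1.3 (i) p.11] -/
theorem incl_comp_toRelTop : RelCosetCat.incl ⊤ ⋙ toRelTop = 𝟭 (RelCosetCat (⊤ : OpenSubgroup G)) := rfl

/-- **`𝓑^temp(Π)⁰ ≌ 𝓑^temp(Π, Π)⁰`** (an isomorphism of the small models). [cite: MochizukiFrdII2008, Ex 1.3 (i) p.11] -/
def relTopEquiv : CosetCat G ≌ RelCosetCat (⊤ : OpenSubgroup G) where
  functor := toRelTop
  inverse := RelCosetCat.incl ⊤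
  unitIso := Iso.refl _
  counitIso := Iso.refl _
  functor_unitIso_comp X := by
    change 𝟙 _ ≫ 𝟙 _ = 𝟙 _
    exact Category.comp_id _

end CosetCat

end Literature.AnabelianGeometry.SemiGraphs

/-! ### §2 `p`-adic Frobenioid data over `CosetCat Π`, restricted to `RelCosetCat ⊤` -/

namespace Literature.AlgebraicGeometry.Frobenioids

namespace PadicFrd

open CategoryTheory Opposite Function Literature.AnabelianGeometry.SemiGraphs QuasiTemperoid

namespace Datum

section RelTop

variable {p : ℕ} [Fact p.Prime] {G : Type} [Group G] [TopologicalSpace G] (d : Datum (CosetCat G) p)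

/-- **The datum over `𝓑^temp(Π, Π)⁰`** obtained from a datum over `𝓑^temp(Π)⁰` by restriction along the inclusion (same
`Φ`, `B`, `B → Φ^gp`, objectwise). [cite: MochizukiFrdII2008, Ex 1.1 (ii) p.8] -/
def relTop : Datum (RelCosetCat (⊤ : OpenSubgroup G)) p where
  base := RelCosetCat.incl ⊤ ⋙ d.base
  isPadicLocal A := d.isPadicLocal A.obj
  isConnected_base := RelCosetCat.isConnected ⊤
  isTotallyEpimorphic_base := RelCosetCat.isTotallyEpimorphic ⊤
  Φ := (RelCosetCat.incl ⊤).op ⋙ d.Φ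
  ι := Functor.whiskerLeft (RelCosetCat.incl ⊤).op d.ι
  ι_injective _ := d.ι_injective _
  isMonoprime _ := d.isMonoprime _
  B := (RelCosetCat.incl ⊤).op ⋙ d.B
  toB0 := Functor.whiskerLeft (RelCosetCat.incl ⊤).op d.toB0
  divB := ModelFrobenioid.divBRestrict (RelCosetCat.incl ⊤) d.Φ d.B d.divB
  square := NatTrans.ext (funext fun A => NatTrans.congr_app d.square ((RelCosetCat.incl ⊤).op.obj A))
  cartesian A := d.cartesian ((RelCosetCat.incl ⊤).op.obj A)
  nonzero A := d.nonzero ((RelCosetCat.incl ⊤).op.obj A)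

/-- The base of the restricted datum is `incl ⊤` followed by the base. [cite: MochizukiFrdII2008, Ex 1.1 (ii) p.8] -/
theorem relTop_base : d.relTop.base = RelCosetCat.incl ⊤ ⋙ d.base := rfl

/-- For the genuine absolute base of §2 (`Π/U ↦ Spec ℚ̄_p^{φ(U)}`, abc-iut-w5-d229's `hd`), the restricted datum lies
over abc-iut-L1-t4's `relBaseGal p ⊤ φ hφ` — the `hd` of abc-iut-L1-t7's relative chain — on the nose.
[cite: MochizukiFrdII2008, Def 2.2 p.17] -/
theorem relTop_base_eq (φ : G →* GalFbar ℚ_[p]) (hφ : IsOpenHom φ)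
    (hd : d.base = CosetCat.push φ hφ.isOpenMap ⋙ CosetCat.toConnected (isTempered_galFbar ℚ_[p]) ⋙ galoisPadicFields p) :
    d.relTop.base = relBaseGal p ⊤ φ hφ := by
  rw [relTop_base, hd]
  rfl

/-- Fieldwise saturation is the same condition objectwise. [cite: MochizukiFrdII2008, Ex 1.1 (ii) pp.8-9] -/
theorem isFieldwiseSaturated_relTop_iff : d.relTop.IsFieldwiseSaturated ↔ d.IsFieldwiseSaturated :=
  ⟨fun h A => h (CosetCat.toRelTop.obj A), fun h A => h A.obj⟩

/-- **`C ⥤ C♭`**: an object `(Π/U, α)` of the model Frobenioid over `𝓑^temp(Π)⁰` IS an object of the model Frobenioid of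
the restricted datum (same class, same morphism data). [cite: MochizukiFrdI2008, Thm. 5.2(i) p.100] -/
def toRelTopFrob : d.frobenioid ⥤ d.relTop.frobenioid where
  obj X := ⟨CosetCat.toRelTop.obj X.base, X.cls⟩
  map {X Y} φ :=
    { degFr := ModelFrobenioid.Hom.degFr (X := X) (Y := Y) φ
      base := CosetCat.toRelTop.map (ModelFrobenioid.Hom.base (X := X) (Y := Y) φ)
      div := ModelFrobenioid.Hom.div (X := X) (Y := Y) φ
      unit := ModelFrobenioid.Hom.unit (X := X) (Y := Y) φ
      rel := ModelFrobenioid.Hom.rel (X := X) (Y := Y) φ }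
  map_id X := by
    apply ModelFrobenioid.hom_ext <;> rfl
  map_comp {X Y Z} φ ψ := by
    apply ModelFrobenioid.hom_ext <;> rfl

/-- **`C♭ ⥤ C`**: abc-iut-w4's base change along `incl ⊤`. [cite: MochizukiFrdI2008, Thm. 5.2(i) p.100] -/
abbrev ofRelTopFrob : d.relTop.frobenioid ⥤ d.frobenioid :=
  ModelFrobenioid.baseChange (RelCosetCat.incl ⊤) d.Φ d.B d.divB

/-- `C ⥤ C♭ ⥤ C` is the identity on the nose. [cite: MochizukiFrdI2008, Thm. 5.2(i) p.100] -/
theorem toRelTopFrob_comp_ofRelTopFrob : d.toRelTopFrob ⋙ d.ofRelTopFrob = 𝟭 d.frobenioid := rfl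

/-- `C♭ ⥤ C ⥤ C♭` is the identity on the nose. [cite: MochizukiFrdI2008, Thm. 5.2(i) p.100] -/
theorem ofRelTopFrob_comp_toRelTopFrob : d.ofRelTopFrob ⋙ d.toRelTopFrob = 𝟭 d.relTop.frobenioid := rfl

/-- **`C ≌ C♭`**: the `p`-adic Frobenioid over `𝓑^temp(Π)⁰` IS the one of the restricted datum over `𝓑^temp(Π, Π)⁰`
(an isomorphism of categories). [cite: MochizukiFrdII2008, Ex 1.3 (i) p.11] -/
def frobRelTopEquiv : d.frobenioid ≌ d.relTop.frobenioid where
  functor := d.toRelTopFrob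
  inverse := d.ofRelTopFrob
  unitIso := Iso.refl _
  counitIso := Iso.refl _
  functor_unitIso_comp X := by
    change 𝟙 _ ≫ 𝟙 _ = 𝟙 _
    exact Category.comp_id _

/-- The object `A♭` lies over `A_D` (as an object of the full subcategory). [cite: MochizukiFrdI2008, Thm. 5.2(i) p.100] -/
theorem toRelTopFrob_obj_base_obj (A : d.frobenioid) : (d.toRelTopFrob.obj A).base.obj = A.base := rfl

/-- `O^⊳(A♭) = O^⊳(A)`: the endomorphism `φ♭` is base-identity of Frobenius degree `1` iff `φ` is.
[cite: MochizukiFrdI2008, Def. 1.2(ii) p.22] -/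
theorem toRelTopFrob_map_mem_endSubmonoid_iff (A : d.frobenioid) (f : A ⟶ A) :
    d.toRelTopFrob.map f ∈ PreFrobenioid.endSubmonoid d.relTop.structureFunctor (d.toRelTopFrob.obj A) ↔
      f ∈ PreFrobenioid.endSubmonoid d.structureFunctor A := by
  rw [ModelFrobenioid.mem_endSubmonoid_iff, ModelFrobenioid.mem_endSubmonoid_iff]
  constructor
  · rintro ⟨h1, h2⟩
    exact ⟨congrArg InducedCategory.Hom.hom h1, h2⟩
  · rintro ⟨h1, h2⟩
    exact ⟨ObjectProperty.hom_ext _ h1, h2⟩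

end RelTop

section Transport

variable {p₁ p₂ : ℕ} [Fact p₁.Prime] [Fact p₂.Prime] {G₁ : Type} [Group G₁] [TopologicalSpace G₁]
  {G₂ : Type} [Group G₂] [TopologicalSpace G₂] {d₁ : Datum (CosetCat G₁) p₁} {d₂ : Datum (CosetCat G₂) p₂}

/-- **Transport of an equivalence `Ψ : C₁ ⥲ C₂` to the restricted data**, `Ψ♭ := (C₁♭ ≌ C₁) ≫ Ψ ≫ (C₂ ≌ C₂♭)`.
[cite: MochizukiFrdII2008, Thm 2.4 (i) p.19] -/
def relTopEquivalence (Ψ : d₁.frobenioid ≌ d₂.frobenioid) : d₁.relTop.frobenioid ≌ d₂.relTop.frobenioid :=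
  (d₁.frobRelTopEquiv.symm.trans Ψ).trans d₂.frobRelTopEquiv

/-- `Ψ♭` on objects: `Ψ♭(A♭) = (Ψ A)♭`, definitionally. [cite: MochizukiFrdII2008, Thm 2.4 (i) p.19] -/
theorem relTopEquivalence_functor_obj (Ψ : d₁.frobenioid ≌ d₂.frobenioid) (A : d₁.frobenioid) :
    (relTopEquivalence Ψ).functor.obj (d₁.toRelTopFrob.obj A) = d₂.toRelTopFrob.obj (Ψ.functor.obj A) := rfl

/-- `Ψ♭` on morphisms: `Ψ♭(f♭) = (Ψ f)♭`, definitionally. [cite: MochizukiFrdII2008, Thm 2.4 (i) p.19] -/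
theorem relTopEquivalence_functor_map (Ψ : d₁.frobenioid ≌ d₂.frobenioid) {A B : d₁.frobenioid} (f : A ⟶ B) :
    (relTopEquivalence Ψ).functor.map (d₁.toRelTopFrob.map f) = d₂.toRelTopFrob.map (Ψ.functor.map f) := rfl

end Transport

end Datum

end PadicFrd

/-! ### §3 Theorem 2.4 (i) from `Ψ` alone, over the absolute bases `CosetCat Πᵢ` -/

namespace PadicKummer.Def22Context

open CategoryTheory Field IntermediateField Kummer Function
open Literature.NumberTheory.GaloisRepresentations
open Literature.AnabelianGeometry.SemiGraphs QuasiTemperoid PadicFrd PadicFrd.Datum PadicFrd.Datum.GaloisChart PadicFrd.RelGal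

section IsoG

variable {p₁ p₂ : ℕ} [Fact p₁.Prime] [Fact p₂.Prime]
  {P₁ : Type} [Group P₁] [TopologicalSpace P₁] [IsTopologicalGroup P₁] [SecondCountableTopology P₁] (hP₁ : IsTempered P₁)
  (hZ₁ : IsSlimGroup P₁) (φ₁ : P₁ →* GalFbar ℚ_[p₁]) (hφ₁ : IsOpenHom φ₁) {P₁₀ : OpenSubgroup P₁}
  {d₁ : PadicFrd.Datum (RelCosetCat P₁₀) p₁} (hd₁ : d₁.base = relBaseGal p₁ P₁₀ φ₁ hφ₁)
  {P₂ : Type} [Group P₂] [TopologicalSpace P₂] [IsTopologicalGroup P₂] (hP₂ : IsTempered P₂) (hZ₂ : IsSlimGroup P₂)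
  (φ₂ : P₂ →* GalFbar ℚ_[p₂]) (hφ₂ : IsOpenHom φ₂) {P₂₀ : OpenSubgroup P₂}
  {d₂ : PadicFrd.Datum (RelCosetCat P₂₀) p₂} (hd₂ : d₂.base = relBaseGal p₂ P₂₀ φ₂ hφ₂)
  (Ψ : d₁.frobenioid ≌ d₂.frobenioid) (A₁ : d₁.frobenioid)

/-- **THE representative `G₁ ⥲ G₂` of abc-iut-L1-t7 gen 6's context isomorphism `isoOfEquivalenceRel`** (the isomorphism of
topological groups `G_{K₁} ⥲ G_{K₂}`, `Kᵢ = ℚ̄_{pᵢ}^{Im Πᵢ}`, induced by the chosen `θ = thetaOfBase` over which `Ψ_Base` lies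
and the base push isomorphism at `A₁`): the map the printed assumption "maps `H₁` onto `H₂`" (`map_H`) and the Theorem 2.4 (ii)
junction "`α ↔ isoG`" refer to. [cite: MochizukiFrdII2008, Thm 2.4 (i) p.19] -/
def isoGOfEquivalenceRel : absoluteGaloisGroup (baseFld p₁ φ₁ hφ₁) ≃ₜ* absoluteGaloisGroup (baseFld p₂ φ₂ hφ₂) :=
  isoGOfTheta φ₁ hφ₁ φ₂ hφ₂ Ψ.functor
    (thetaOfBase hP₁ hP₂ Ψ.functor (baseEquivalenceOf hP₁ hZ₁ hP₂ hZ₂ Ψ) (baseEquivalenceIso hP₁ hZ₁ hP₂ hZ₂ Ψ))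
    (continuous_thetaOfBase hP₁ hP₂ Ψ.functor (baseEquivalenceOf hP₁ hZ₁ hP₂ hZ₂ Ψ) (baseEquivalenceIso hP₁ hZ₁ hP₂ hZ₂ Ψ))
    (isOpenMap_thetaOfBase hP₁ hP₂ Ψ.functor (baseEquivalenceOf hP₁ hZ₁ hP₂ hZ₂ Ψ) (baseEquivalenceIso hP₁ hZ₁ hP₂ hZ₂ Ψ))
    (bijective_thetaOfBase hP₁ hP₂ Ψ.functor (baseEquivalenceOf hP₁ hZ₁ hP₂ hZ₂ Ψ) (baseEquivalenceIso hP₁ hZ₁ hP₂ hZ₂ Ψ)).2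
    (hker_thetaOfBase hP₁ φ₁ hφ₁ hd₁ hP₂ φ₂ hφ₂ hd₂ Ψ.functor (baseEquivalenceOf hP₁ hZ₁ hP₂ hZ₂ Ψ)
      (baseEquivalenceIso hP₁ hZ₁ hP₂ hZ₂ Ψ) (map_mem_endSubmonoid_iff hP₁ hZ₁ hP₂ hZ₂ Ψ))
    (baseIsoOfPush Ψ.functor
      (thetaOfBase hP₁ hP₂ Ψ.functor (baseEquivalenceOf hP₁ hZ₁ hP₂ hZ₂ Ψ) (baseEquivalenceIso hP₁ hZ₁ hP₂ hZ₂ Ψ))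
      (isOpenMap_thetaOfBase hP₁ hP₂ Ψ.functor (baseEquivalenceOf hP₁ hZ₁ hP₂ hZ₂ Ψ) (baseEquivalenceIso hP₁ hZ₁ hP₂ hZ₂ Ψ))
      (basePushIsoOfBase hP₁ hP₂ Ψ.functor (baseEquivalenceOf hP₁ hZ₁ hP₂ hZ₂ Ψ) (baseEquivalenceIso hP₁ hZ₁ hP₂ hZ₂ Ψ))
      A₁)

variable {φ₁ hφ₁ φ₂ hφ₂ A₁} (hA₁ : A₁.base.obj.sg.toSubgroup.Normal) (hA₂ : (Ψ.functor.obj A₁).base.obj.sg.toSubgroup.Normal)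
  {H₁ : Subgroup (absoluteGaloisGroup (baseFld p₁ φ₁ hφ₁))} [H₁.Normal]
  {hH₁ : IsOpen (H₁ : Set (absoluteGaloisGroup (baseFld p₁ φ₁ hφ₁)))}
  {H₂ : Subgroup (absoluteGaloisGroup (baseFld p₂ φ₂ hφ₂))} [H₂.Normal]
  {hH₂ : IsOpen (H₂ : Set (absoluteGaloisGroup (baseFld p₂ φ₂ hφ₂)))}
  (map_H : H₁.map (isoGOfEquivalenceRel hP₁ hZ₁ φ₁ hφ₁ hd₁ hP₂ hZ₂ φ₂ hφ₂ hd₂ Ψ A₁).toMulEquiv.toMonoidHom = H₂)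

/-- The context isomorphism's `isoG` IS `isoGOfEquivalenceRel` (by construction). [cite: MochizukiFrdII2008, Thm 2.4 (i) p.19] -/
theorem isoOfEquivalenceRel_isoG :
    (isoOfEquivalenceRel hP₁ hZ₁ hd₁ hP₂ hZ₂ hd₂ Ψ hA₁ hA₂ (hH₁ := hH₁) (hH₂ := hH₂) map_H).isoG =
      isoGOfEquivalenceRel hP₁ hZ₁ φ₁ hφ₁ hd₁ hP₂ hZ₂ φ₂ hφ₂ hd₂ Ψ A₁ := rfl

end IsoG

section Abs

variable {p₁ p₂ : ℕ} [Fact p₁.Prime] [Fact p₂.Prime]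
  {P₁ : Type} [Group P₁] [TopologicalSpace P₁] [IsTopologicalGroup P₁] [SecondCountableTopology P₁] (hP₁ : IsTempered P₁)
  (hZ₁ : IsSlimGroup P₁) {φ₁ : P₁ →* GalFbar ℚ_[p₁]} {hφ₁ : IsOpenHom φ₁}
  {d₁ : PadicFrd.Datum (CosetCat P₁) p₁}
  (hd₁ : d₁.base = CosetCat.push φ₁ hφ₁.isOpenMap ⋙ CosetCat.toConnected (isTempered_galFbar ℚ_[p₁]) ⋙ galoisPadicFields p₁)
  {P₂ : Type} [Group P₂] [TopologicalSpace P₂] [IsTopologicalGroup P₂] (hP₂ : IsTempered P₂) (hZ₂ : IsSlimGroup P₂)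
  {φ₂ : P₂ →* GalFbar ℚ_[p₂]} {hφ₂ : IsOpenHom φ₂}
  {d₂ : PadicFrd.Datum (CosetCat P₂) p₂}
  (hd₂ : d₂.base = CosetCat.push φ₂ hφ₂.isOpenMap ⋙ CosetCat.toConnected (isTempered_galFbar ℚ_[p₂]) ⋙ galoisPadicFields p₂)
  (Ψ : d₁.frobenioid ≌ d₂.frobenioid)
  {A₁ : d₁.frobenioid} (hA₁ : A₁.base.sg.toSubgroup.Normal) (hA₂ : (Ψ.functor.obj A₁).base.sg.toSubgroup.Normal)
  {H₁ : Subgroup (absoluteGaloisGroup (baseFld p₁ φ₁ hφ₁))} [H₁.Normal]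
  {hH₁ : IsOpen (H₁ : Set (absoluteGaloisGroup (baseFld p₁ φ₁ hφ₁)))}
  {H₂ : Subgroup (absoluteGaloisGroup (baseFld p₂ φ₂ hφ₂))} [H₂.Normal]
  {hH₂ : IsOpen (H₂ : Set (absoluteGaloisGroup (baseFld p₂ φ₂ hφ₂)))}
  (map_H : H₁.map (isoGOfEquivalenceRel hP₁ hZ₁ φ₁ hφ₁ (d₁.relTop_base_eq φ₁ hφ₁ hd₁) hP₂ hZ₂ φ₂ hφ₂
    (d₂.relTop_base_eq φ₂ hφ₂ hd₂) (relTopEquivalence Ψ) (d₁.toRelTopFrob.obj A₁)).toMulEquiv.toMonoidHom = H₂)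
  (N : ℕ) [NeZero N]
  (hμ₁ : ∀ ζ : rootsOfUnity N (AlgebraicClosure (baseFld p₁ φ₁ hφ₁)),
    ((ζ : (AlgebraicClosure (baseFld p₁ φ₁ hφ₁))ˣ) : AlgebraicClosure (baseFld p₁ φ₁ hφ₁)) ∈
      objL φ₁ hφ₁ d₁.relTop (d₁.toRelTopFrob.obj A₁))
  (hμ₂ : ∀ ζ : rootsOfUnity N (AlgebraicClosure (baseFld p₂ φ₂ hφ₂)),
    ((ζ : (AlgebraicClosure (baseFld p₂ φ₂ hφ₂))ˣ) : AlgebraicClosure (baseFld p₂ φ₂ hφ₂)) ∈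
      objL φ₂ hφ₂ d₂.relTop (d₂.toRelTopFrob.obj (Ψ.functor.obj A₁)))

/-- **Definition 2.2 for an object `A` (`A_D = Π/V`, `V ⊴ Π`) of a `p`-adic Frobenioid over the ABSOLUTE genuine base
`CosetCat Π → D₀` of §2** (abc-iut-w5-d229's convention): abc-iut-L1-t7's `contextOfObjectRel` at the restricted datum and
the object `A♭`. [cite: MochizukiFrdII2008, Def 2.2 (i) p.17] -/
abbrev contextOfObjectAbs {p : ℕ} [Fact p.Prime] {P : Type} [Group P] [TopologicalSpace P] (φ : P →* GalFbar ℚ_[p])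
    (hφ : IsOpenHom φ) (d : PadicFrd.Datum (CosetCat P) p)
    (hd : d.base = CosetCat.push φ hφ.isOpenMap ⋙ CosetCat.toConnected (isTempered_galFbar ℚ_[p]) ⋙ galoisPadicFields p)
    (A : d.frobenioid) (hA : A.base.sg.toSubgroup.Normal) (H : Subgroup (absoluteGaloisGroup (baseFld p φ hφ))) [H.Normal]
    (hH : IsOpen (H : Set (absoluteGaloisGroup (baseFld p φ hφ)))) : PadicKummer.Def22Context :=
  contextOfObjectRel φ hφ d.relTop (d.relTop_base_eq φ hφ hd) (d.toRelTopFrob.obj A) hA H hH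

/-- **The isomorphism of Definition 2.2 contexts of `A₁`, `Ψ A₁` induced by an equivalence `Ψ` of `p`-adic Frobenioids
over the ABSOLUTE bases `CosetCat Πᵢ`** (abc-iut-L1-t7 gen 6's `isoOfEquivalenceRel` at `Ψ♭`): residual (R1) of the Theorem
2.4 (ii) closer on abc-iut-w5-d229's data. [cite: MochizukiFrdII2008, Thm 2.4 (i) p.19] -/
def isoOfEquivalenceAbs :
    (contextOfObjectAbs φ₁ hφ₁ d₁ hd₁ A₁ hA₁ H₁ hH₁).Iso (contextOfObjectAbs φ₂ hφ₂ d₂ hd₂ (Ψ.functor.obj A₁) hA₂ H₂ hH₂) :=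
  isoOfEquivalenceRel hP₁ hZ₁ (d₁.relTop_base_eq φ₁ hφ₁ hd₁) hP₂ hZ₂ (d₂.relTop_base_eq φ₂ hφ₂ hd₂) (relTopEquivalence Ψ)
    (A₁ := d₁.toRelTopFrob.obj A₁) hA₁ hA₂ map_H

/-- Its `isoG` is the named representative `isoGOfEquivalenceRel` at `Ψ♭`, `A₁♭`. [cite: MochizukiFrdII2008, Thm 2.4 (i) p.19] -/
theorem isoOfEquivalenceAbs_isoG :
    (isoOfEquivalenceAbs hP₁ hZ₁ hd₁ hP₂ hZ₂ hd₂ Ψ hA₁ hA₂ (hH₁ := hH₁) (hH₂ := hH₂) map_H).isoG =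
      isoGOfEquivalenceRel hP₁ hZ₁ φ₁ hφ₁ (d₁.relTop_base_eq φ₁ hφ₁ hd₁) hP₂ hZ₂ φ₂ hφ₂ (d₂.relTop_base_eq φ₂ hφ₂ hd₂)
        (relTopEquivalence Ψ) (d₁.toRelTopFrob.obj A₁) := rfl

/-- Its `isoC` is `Ψ` on automorphisms (through `Aut A♭ = Aut A`): `(isoC a).hom = (Ψ a.hom)♭`.
[cite: MochizukiFrdII2008, Thm 2.4 (i) p.19] -/
theorem isoOfEquivalenceAbs_isoC_hom (a : Aut (d₁.toRelTopFrob.obj A₁)) :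
    ((isoOfEquivalenceAbs hP₁ hZ₁ hd₁ hP₂ hZ₂ hd₂ Ψ hA₁ hA₂ (hH₁ := hH₁) (hH₂ := hH₂) map_H).isoC a).hom =
      d₂.toRelTopFrob.map (Ψ.functor.map (d₁.ofRelTopFrob.map a.hom)) := rfl

/-- **[FrdII] Theorem 2.4 (i) for the `p`-adic Frobenioids over the ABSOLUTE genuine bases `Dᵢ = 𝓑^temp(Πᵢ)⁰` (small model
`CosetCat Πᵢ`, `Πᵢ/U ↦ Spec ℚ̄_{pᵢ}^{φᵢ(U)}`) from an EQUIVALENCE `Ψ : C₁ ⥲ C₂` alone** — abc-iut-L1-t7 gen 6's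
`thm24i_ofEquivalenceRel` transported along `𝓑^temp(Π)⁰ = 𝓑^temp(Π, Π)⁰`; standing hypotheses and the two residual named
inputs {`map_H` (printed assumption), `hfs` (row L03; discharged downstream by abc-iut-L1-t10's `thm24i_ofEquivalenceRel_hfs`)}
exactly as there. [cite: MochizukiFrdII2008, Thm 2.4 (i) p.19] -/
theorem thm24i_ofEquivalenceAbs (fs₁ fs₂ : Prop) (hfs : fs₁ ↔ fs₂)
    (eFN₁ : FN (contextOfObjectAbs φ₁ hφ₁ d₁ hd₁ A₁ hA₁ H₁ hH₁) N ≃+ ZMod N)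
    (hc₁ : IsNHSaturated (contextOfObjectAbs φ₁ hφ₁ d₁ hd₁ A₁ hA₁ H₁ hH₁) N) :
    haveI := finiteDimensional_objL φ₁ hφ₁ d₁.relTop (d₁.toRelTopFrob.obj A₁)
    haveI := normal_objL φ₁ hφ₁ d₁.relTop (d₁.toRelTopFrob.obj A₁) hA₁
    haveI := finiteDimensional_objL φ₂ hφ₂ d₂.relTop (d₂.toRelTopFrob.obj (Ψ.functor.obj A₁))
    haveI := normal_objL φ₂ hφ₂ d₂.relTop (d₂.toRelTopFrob.obj (Ψ.functor.obj A₁)) hA₂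
    haveI := finiteDimensional_baseFld p₁ φ₁ hφ₁; haveI := finiteDimensional_baseFld p₂ φ₂ hφ₂
    haveI := locallyCompactSpace_H_contextOfObjectRel φ₁ hφ₁ d₁.relTop (d₁.relTop_base_eq φ₁ hφ₁ hd₁)
      (d₁.toRelTopFrob.obj A₁) hA₁ H₁ hH₁
    haveI := locallyCompactSpace_H_contextOfObjectRel φ₂ hφ₂ d₂.relTop (d₂.relTop_base_eq φ₂ hφ₂ hd₂)
      (d₂.toRelTopFrob.obj (Ψ.functor.obj A₁)) hA₂ H₂ hH₂
    letI := (galoisChartRel φ₁ hφ₁ d₁.relTop (d₁.relTop_base_eq φ₁ hφ₁ hd₁) (d₁.toRelTopFrob.obj A₁) hA₁).galAction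
    letI := (galoisChartRel φ₂ hφ₂ d₂.relTop (d₂.relTop_base_eq φ₂ hφ₂ hd₂)
      (d₂.toRelTopFrob.obj (Ψ.functor.obj A₁)) hA₂).galAction
    Thm24i (contextOfObjectAbs φ₁ hφ₁ d₁ hd₁ A₁ hA₁ H₁ hH₁) (contextOfObjectAbs φ₂ hφ₂ d₂ hd₂ (Ψ.functor.obj A₁) hA₂ H₂ hH₂)
      N p₁ p₂ fs₁ fs₂ ((isoOfEquivalenceAbs hP₁ hZ₁ hd₁ hP₂ hZ₂ hd₂ Ψ hA₁ hA₂ map_H).thm24Data N)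
      ((contextOfObjectAbs φ₁ hφ₁ d₁ hd₁ A₁ hA₁ H₁ hH₁).dualityIsoOfLocalDuality N eFN₁ hc₁
        (cupDualH_bijective_ofGalois_mlf p₁ (objL φ₁ hφ₁ d₁.relTop (d₁.toRelTopFrob.obj A₁)) H₁ hH₁
          (galoisChartRel φ₁ hφ₁ d₁.relTop (d₁.relTop_base_eq φ₁ hφ₁ hd₁) (d₁.toRelTopFrob.obj A₁) hA₁).res
          (galoisChartRel φ₁ hφ₁ d₁.relTop (d₁.relTop_base_eq φ₁ hφ₁ hd₁) (d₁.toRelTopFrob.obj A₁) hA₁).res_smul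
          ((galoisChartRel φ₁ hφ₁ d₁.relTop (d₁.relTop_base_eq φ₁ hφ₁ hd₁) (d₁.toRelTopFrob.obj A₁) hA₁).muModel N hμ₁)))
      ((contextOfObjectAbs φ₂ hφ₂ d₂ hd₂ (Ψ.functor.obj A₁) hA₂ H₂ hH₂).dualityIsoOfLocalDuality N
        (((isoOfEquivalenceAbs hP₁ hZ₁ hd₁ hP₂ hZ₂ hd₂ Ψ hA₁ hA₂ map_H).isoFN N).symm.trans eFN₁)
        (((isoOfEquivalenceAbs hP₁ hZ₁ hd₁ hP₂ hZ₂ hd₂ Ψ hA₁ hA₂ map_H).isNHSaturated_iff N).mp hc₁)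
        (cupDualH_bijective_ofGalois_mlf p₂ (objL φ₂ hφ₂ d₂.relTop (d₂.toRelTopFrob.obj (Ψ.functor.obj A₁))) H₂ hH₂
          (galoisChartRel φ₂ hφ₂ d₂.relTop (d₂.relTop_base_eq φ₂ hφ₂ hd₂) (d₂.toRelTopFrob.obj (Ψ.functor.obj A₁)) hA₂).res
          (galoisChartRel φ₂ hφ₂ d₂.relTop (d₂.relTop_base_eq φ₂ hφ₂ hd₂)
            (d₂.toRelTopFrob.obj (Ψ.functor.obj A₁)) hA₂).res_smul
          ((galoisChartRel φ₂ hφ₂ d₂.relTop (d₂.relTop_base_eq φ₂ hφ₂ hd₂)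
            (d₂.toRelTopFrob.obj (Ψ.functor.obj A₁)) hA₂).muModel N hμ₂))) :=
  thm24i_ofEquivalenceRel hP₁ hZ₁ (d₁.relTop_base_eq φ₁ hφ₁ hd₁) hP₂ hZ₂ (d₂.relTop_base_eq φ₂ hφ₂ hd₂)
    (relTopEquivalence Ψ) (A₁ := d₁.toRelTopFrob.obj A₁) hA₁ hA₂ map_H N hμ₁ hμ₂ fs₁ fs₂ hfs eFN₁ hc₁

end Abs

end PadicKummer.Def22Context

end Literature.AlgebraicGeometry.Frobenioids

end
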